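import Summits.MatrixMultiplication.MatrixMultiplication.Theorems.FarEdgeDescentConverseRigidity
import HarnessLib

/-!
# Far-edge descent — twist rigidity, core: multi-twisted stars and the transfer identities

Support file for route `FarEdgeDescent` (aside `SubLogRate`), kernel VI of the lineage
`decomp-mm-lens-2` («structural dichotomy, special vs generic»); cut of record (rev 13)
`FiniteSaturation ∧ AnchoredLogConvexity → MatrixMultiplication` UNCHANGED.

A **multi-twisted star** with leaf-tag type `γ` and twist assignment `e : γ → Perm (α × α)` is the
`x`-shared star whose leaf `s` computes `e_s(X) · y_s`, where `e_s(X)` is the matrix `X` with its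
entries MOVED by the permutation `e_s` of the index grid (`e_s(X)_{e_s b} = X_b`).  In the leaf
coordinates of Kernel IV (`FarEdgeDescentConverseRigidityCore.routed`) it is the routed star with
row router `trow e s b = (e s b).1` and column router `tcol e s b = (e s b).2`; the coherent star
`⟨n,n,|γ|⟩` is `e ≡ 1`, the twisted star `𝔖_n(L)` is `e = (1 on inl, ᵀ on inr)`.

This file proves the two **transfer identities** for a pair `(β, γ')` intertwining the slice
pencil of the `N`-th Kronecker power of a multi-twisted star (`β T_b = T_b γ'` for all slices):
one instance of the relation per entry expresses `β(u,z)` through an entry of `γ'` and vice versa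
(`transfer_fst`, `transfer_snd`), the position-`i` data entering only through the RELATIVE TWIST
`rel e (u i).2 (z i).2 = e_{(u i).2} ∘ e_{(z i).2}⁻¹`.  Chasing the two identities three times gives the
combinatorial heart (`isProdPerm_of_transport`): if `β(u,z) ≠ 0` then the relative twist at every
position transports whole rows to rows and whole columns to columns, i.e. it is a **product
permutation** `(i, j) ↦ (σ i, τ j)` (`IsProdPerm`).  Contrapositive (`fst_eq_zero_of_not_isProdPerm`,
`snd_eq_zero_of_not_isProdPerm`): at a position whose relative twist is NOT a product permutation,
every intertwining pair vanishes.  The last section defines the **`φ`-twisted star** `𝔖_φ`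
(`permStar`; `permStar_prodComm : 𝔖_ᵀ = twistedStar`) and its leaf form; `FarEdgeDescentTwistRigidity`
turns all this into the dichotomy «`⟨n,n,2L⟩^{⊠N} ⊵ 𝔖_φ^{⊠N}` iff `φ` is a product permutation».

[cite: BurgisserClausenShokrollahi1997, (15.19)–(15.25); Strassen1988, §3]
-/

noncomputable section

open scoped BigOperators

set_option linter.dupNamespace false

namespace Summit.MatrixMultiplication.MatrixMultiplication.Theorems.FarEdgeDescentTwistRigidity

open Literature.Computability.AlgebraicComplexity
open Summit.MatrixMultiplication.MatrixMultiplication.Theorems.FarEdgeDescentCommutantObstruction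
open Summit.MatrixMultiplication.MatrixMultiplication.Theorems.FarEdgeDescentConverseRigidity
open Summit.MatrixMultiplication.MatrixMultiplication.Theorems.FarEdgeDescentTwistedStar

/-! ## Product permutations of a square grid -/

section ProdPerm

variable {α : Type*}

/-- `φ` is a **product permutation** of the grid `α × α`: `φ (i, j) = (σ i, τ j)` for two maps
`σ, τ` (automatically bijections).  These are the twists under which the twisted leaf is the
coherent leaf relabelled. [folklore] -/
def IsProdPerm (φ : Equiv.Perm (α × α)) : Prop :=
  ∃ σ τ : α → α, ∀ b, φ b = (σ b.1, τ b.2)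

/-- The identity is a product permutation. [folklore] -/
theorem IsProdPerm.refl : IsProdPerm (Equiv.refl (α × α)) :=
  ⟨id, id, fun _ => rfl⟩

/-- The first factor of a product permutation is injective. [folklore] -/
theorem IsProdPerm.injective_fst {φ : Equiv.Perm (α × α)} {σ τ : α → α}
    (h : ∀ b, φ b = (σ b.1, τ b.2)) : Function.Injective σ := by
  intro i i' hii'
  have e : φ (i, i) = φ (i', i) := by rw [h, h, hii']
  exact (Prod.ext_iff.mp (φ.injective e)).1

/-- The second factor of a product permutation is injective. [folklore] -/
theorem IsProdPerm.injective_snd {φ : Equiv.Perm (α × α)} {σ τ : α → α}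
    (h : ∀ b, φ b = (σ b.1, τ b.2)) : Function.Injective τ := by
  intro j j' hjj'
  have e : φ (j, j) = φ (j, j') := by rw [h, h, hjj']
  exact (Prod.ext_iff.mp (φ.injective e)).2

/-- The inverse of a product permutation is a product permutation. [folklore] -/
theorem IsProdPerm.symm {φ : Equiv.Perm (α × α)} (hφ : IsProdPerm φ) : IsProdPerm φ.symm := by
  obtain ⟨σ, τ, h⟩ := hφ
  refine ⟨fun r => (φ.symm (r, r)).1, fun c => (φ.symm (c, c)).2, fun b => ?_⟩
  obtain ⟨r, c⟩ := b
  have e := φ.apply_symm_apply (r, c)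
  have e₁ := φ.apply_symm_apply (r, r)
  have e₂ := φ.apply_symm_apply (c, c)
  rw [h] at e e₁ e₂
  simp only [Prod.mk.injEq] at e e₁ e₂
  have h₁ : ((φ.symm (r, r)).1, (φ.symm (r, c)).2) = φ.symm (r, c) := by
    apply φ.injective
    rw [h, h]
    exact Prod.ext (e₁.1.trans e.1.symm) rfl
  have h₂ : ((φ.symm (r, c)).1, (φ.symm (c, c)).2) = φ.symm (r, c) := by
    apply φ.injective
    rw [h, h]
    exact Prod.ext rfl (e₂.2.trans e.2.symm)
  exact Prod.ext (Prod.ext_iff.mp h₁).1.symm (Prod.ext_iff.mp h₂).2.symm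

/-- A permutation transporting every row to a row and every column to a column is a product
permutation. [folklore] -/
theorem isProdPerm_of_rows_cols (φ : Equiv.Perm (α × α))
    (hr : ∀ r, ∃ r', ∀ m, (φ (r, m)).1 = r') (hc : ∀ c, ∃ c', ∀ m, (φ (m, c)).2 = c') :
    IsProdPerm φ := by
  choose σ hσ using hr
  choose τ hτ using hc
  refine ⟨σ, τ, fun b => ?_⟩
  obtain ⟨i, j⟩ := b
  exact Prod.ext (hσ i j) (hτ j i)

variable [Finite α]

/-- **The combinatorial heart.**  If for some map `τ` the inverse `ψ⁻¹` sends every point of column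
`τ y` into column `y`, and `ψ` sends the whole row of each such preimage point back to the row it
came from, then `ψ` is a product permutation: the preimage map `x ↦ (ψ⁻¹ (x, τ y)).1` is injective,
hence onto (finiteness), so EVERY row and every column is transported. [folklore] -/
theorem isProdPerm_of_transport (ψ : Equiv.Perm (α × α)) (τ : α → α)
    (h₂ : ∀ y x, (ψ.symm (x, τ y)).2 = y)
    (h₃ : ∀ y x m, (ψ ((ψ.symm (x, τ y)).1, m)).1 = x) : IsProdPerm ψ := by
  have hκ : ∀ y, Function.Surjective fun x => (ψ.symm (x, τ y)).1 := by
    intro y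
    refine Finite.surjective_of_injective fun x x' hxx' => ?_
    have e : ψ.symm (x, τ y) = ψ.symm (x', τ y) :=
      Prod.ext hxx' ((h₂ y x).trans (h₂ y x').symm)
    exact (Prod.ext_iff.mp (ψ.symm.injective e)).1
  refine isProdPerm_of_rows_cols ψ (fun r => ?_) (fun c => ?_)
  · obtain ⟨x, hx⟩ := hκ r r
    dsimp only at hx
    exact ⟨x, fun m => by rw [← hx]; exact h₃ r x m⟩
  · refine ⟨τ c, fun m => ?_⟩
    obtain ⟨x, hx⟩ := hκ c m
    dsimp only at hx
    have e : ψ.symm (x, τ c) = (m, c) := Prod.ext hx (h₂ c x)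
    have e' : ψ (m, c) = (x, τ c) := by rw [← e, Equiv.apply_symm_apply]
    rw [e']

end ProdPerm

/-! ## Multi-twisted stars: routers and relative twists -/

section Transfer

variable {R : Type*} [CommSemiring R] {α γ : Type*}

/-- Row router of the multi-twisted star with twist assignment `e`: leaf `s` routes the `X`-index
`b` to the row of `e s b`. [folklore] -/
def trow (e : γ → Equiv.Perm (α × α)) (s : γ) (b : α × α) : α := (e s b).1

/-- Column router of the multi-twisted star with twist assignment `e`. [folklore] -/
def tcol (e : γ → Equiv.Perm (α × α)) (s : γ) (b : α × α) : α := (e s b).2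

/-- The **relative twist** between the leaves `s` and `s'`: `e_s ∘ e_{s'}⁻¹`. [folklore] -/
def rel (e : γ → Equiv.Perm (α × α)) (s s' : γ) : Equiv.Perm (α × α) := (e s').symm.trans (e s)

/-- Pointwise form of the relative twist. [folklore] -/
@[simp] theorem rel_apply (e : γ → Equiv.Perm (α × α)) (s s' : γ) (x : α × α) :
    rel e s s' x = e s ((e s').symm x) := rfl

/-- The relative twist the other way round is the inverse. [folklore] -/
theorem rel_symm_apply (e : γ → Equiv.Perm (α × α)) (s s' : γ) (x : α × α) :
    (rel e s s').symm x = rel e s' s x := by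
  simp [rel]

/-- The relative twist the other way round is the inverse (as permutations). [folklore] -/
theorem rel_symm (e : γ → Equiv.Perm (α × α)) (s s' : γ) : (rel e s s').symm = rel e s' s :=
  Equiv.ext (rel_symm_apply e s s')

variable [DecidableEq α] [DecidableEq γ] [Fintype α] [Fintype γ] {N : ℕ}

/-- **First transfer identity.**  For a pair `(β, γ')` intertwining the slice pencil of the `N`-th
power of the multi-twisted star and any choice of auxiliary columns `m`, the entry `β(u,z)` is an
entry of `γ'` if at every position the relative twist sends `((z i).1, m i)` into the row `(u i).1`,
and `0` otherwise.  One test slice: `b i = e_{(z i).2}⁻¹ ((z i).1, m i)`. [folklore] -/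
theorem transfer_fst (e : γ → Equiv.Perm (α × α))
    (β γ' : Matrix (Fin N → α × γ) (Fin N → α × γ) R)
    (h : ∀ b, β * slice (kroneckerPow (routed (R := R) (trow e) (tcol e)) N) b =
      slice (kroneckerPow (routed (R := R) (trow e) (tcol e)) N) b * γ')
    (u z : Fin N → α × γ) (m : Fin N → α) :
    β u z = if ∀ i, (u i).1 = (rel e (u i).2 (z i).2 ((z i).1, m i)).1 then
      γ' (fun i => ((rel e (u i).2 (z i).2 ((z i).1, m i)).2, (u i).2)) (fun i => (m i, (z i).2))
      else 0 := by
  set b : Fin N → α × α := fun i => (e (z i).2).symm ((z i).1, m i) with hb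
  set w : Fin N → α × γ := fun i => (m i, (z i).2) with hw
  have key := congr_fun (congr_fun (h b) u) w
  rw [mul_slicePow_apply, slicePow_mul_apply] at key
  have hc : ∀ i, tcol e (w i).2 (b i) = (w i).1 := fun i => by
    simp only [hw, hb, tcol, Equiv.apply_symm_apply]
  have hz : (fun i => (trow e (w i).2 (b i), (w i).2)) = z := funext fun i => by
    simp only [hw, hb, trow, Equiv.apply_symm_apply, Prod.mk.eta]
  rw [if_pos hc, hz] at key
  rw [key]
  simp only [hb, hw, trow, tcol, rel_apply]

/-- **Second transfer identity.**  Dually, for auxiliary rows `x` the entry `γ'(v,w)` is an entry of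
`β` if at every position the inverse relative twist sends `(x i, (v i).1)` into the column `(w i).1`,
and `0` otherwise.  One test slice: `b i = e_{(v i).2}⁻¹ (x i, (v i).1)`. [folklore] -/
theorem transfer_snd (e : γ → Equiv.Perm (α × α))
    (β γ' : Matrix (Fin N → α × γ) (Fin N → α × γ) R)
    (h : ∀ b, β * slice (kroneckerPow (routed (R := R) (trow e) (tcol e)) N) b =
      slice (kroneckerPow (routed (R := R) (trow e) (tcol e)) N) b * γ')
    (v w : Fin N → α × γ) (x : Fin N → α) :
    γ' v w = if ∀ i, (rel e (w i).2 (v i).2 (x i, (v i).1)).2 = (w i).1 then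
      β (fun i => (x i, (v i).2)) (fun i => ((rel e (w i).2 (v i).2 (x i, (v i).1)).1, (w i).2))
      else 0 := by
  set b : Fin N → α × α := fun i => (e (v i).2).symm (x i, (v i).1) with hb
  set u : Fin N → α × γ := fun i => (x i, (v i).2) with hu
  have key := congr_fun (congr_fun (h b) u) w
  rw [mul_slicePow_apply, slicePow_mul_apply] at key
  have hp : ∀ i, (u i).1 = trow e (u i).2 (b i) := fun i => by
    simp only [hu, hb, trow, Equiv.apply_symm_apply]
  have hv : (fun i => (tcol e (u i).2 (b i), (u i).2)) = v := funext fun i => by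
    simp only [hu, hb, tcol, Equiv.apply_symm_apply, Prod.mk.eta]
  rw [if_pos hp, hv] at key
  rw [← key]
  simp only [hb, hu, trow, tcol, rel_apply]

/-- **Vanishing of `β` at a non-product relative twist.**  If the relative twist at some position
`i₀` is not a product permutation, then `β(u,z) = 0` for every intertwining pair `(β, γ')`: a nonzero
entry would, by three transfers (`β → γ' → β`), make the relative twist transport all rows and all
columns (`isProdPerm_of_transport`). [folklore] -/
theorem fst_eq_zero_of_not_isProdPerm (e : γ → Equiv.Perm (α × α))
    (β γ' : Matrix (Fin N → α × γ) (Fin N → α × γ) R)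
    (h : ∀ b, β * slice (kroneckerPow (routed (R := R) (trow e) (tcol e)) N) b =
      slice (kroneckerPow (routed (R := R) (trow e) (tcol e)) N) b * γ')
    (u z : Fin N → α × γ) (i₀ : Fin N) (hψ : ¬ IsProdPerm (rel e (u i₀).2 (z i₀).2)) :
    β u z = 0 := by
  by_contra hne
  apply hψ
  -- the data at the other positions is carried along; only position `i₀` is read off
  -- Step 1 (`β → γ'`): rows of `(z i₀).1` go to the row `(u i₀).1`, and the `γ'`-entry is nonzero
  have step1 : ∀ y : α,
      γ' (fun i => ((rel e (u i).2 (z i).2 ((z i).1, y)).2, (u i).2)) (fun i => (y, (z i).2)) ≠ 0 := by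
    intro y
    have t := transfer_fst e β γ' h u z (fun _ => y)
    by_cases hc : ∀ i, (u i).1 = (rel e (u i).2 (z i).2 ((z i).1, y)).1
    · rw [if_pos hc] at t
      exact fun h0 => hne (t.trans h0)
    · rw [if_neg hc] at t
      exact absurd t hne
  -- Step 2 (`γ' → β`): the inverse twist sends column `τ y` into column `y`, and the `β`-entry is nonzero
  have step2 : ∀ y x₀ : α,
      ((rel e (u i₀).2 (z i₀).2).symm (x₀, (rel e (u i₀).2 (z i₀).2 ((z i₀).1, y)).2)).2 = y ∧
      β (fun i => (x₀, (u i).2))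
        (fun i => ((rel e (z i).2 (u i).2 (x₀, (rel e (u i).2 (z i).2 ((z i).1, y)).2)).1,
          (z i).2)) ≠ 0 := by
    intro y x₀
    have hγ := step1 y
    have t := transfer_snd e β γ' h
      (fun i => ((rel e (u i).2 (z i).2 ((z i).1, y)).2, (u i).2)) (fun i => (y, (z i).2))
      (fun _ => x₀)
    by_cases hc : ∀ i,
        (rel e (z i).2 (u i).2 (x₀, (rel e (u i).2 (z i).2 ((z i).1, y)).2)).2 = y
    · rw [if_pos hc] at t
      refine ⟨?_, fun h0 => hγ (t.trans h0)⟩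
      rw [rel_symm_apply]
      exact hc i₀
    · rw [if_neg hc] at t
      exact absurd t hγ
  -- Step 3 (`β → γ'` again): the row of each preimage point goes back to the row `x₀`
  have step3 : ∀ y x₀ m₀ : α,
      (rel e (u i₀).2 (z i₀).2
        (((rel e (u i₀).2 (z i₀).2).symm (x₀, (rel e (u i₀).2 (z i₀).2 ((z i₀).1, y)).2)).1,
          m₀)).1 = x₀ := by
    intro y x₀ m₀
    obtain ⟨-, hβ⟩ := step2 y x₀
    have t := transfer_fst e β γ' h (fun i => (x₀, (u i).2))
      (fun i => ((rel e (z i).2 (u i).2 (x₀, (rel e (u i).2 (z i).2 ((z i).1, y)).2)).1, (z i).2))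
      (fun _ => m₀)
    by_cases hc : ∀ i, ((fun i => (x₀, (u i).2)) i).1 =
        (rel e ((fun i => (x₀, (u i).2)) i).2 (z i).2
          (((rel e (z i).2 (u i).2 (x₀, (rel e (u i).2 (z i).2 ((z i).1, y)).2)).1), m₀)).1
    · have := (hc i₀).symm
      rw [rel_symm_apply]
      exact this
    · simp only at hc t
      rw [if_neg hc] at t
      exact absurd t hβ
  exact isProdPerm_of_transport (rel e (u i₀).2 (z i₀).2)
    (fun y => (rel e (u i₀).2 (z i₀).2 ((z i₀).1, y)).2) (fun y x₀ => (step2 y x₀).1) step3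

/-- **Vanishing of `γ'` at a non-product relative twist** (one more transfer `γ' → β`). [folklore] -/
theorem snd_eq_zero_of_not_isProdPerm (e : γ → Equiv.Perm (α × α))
    (β γ' : Matrix (Fin N → α × γ) (Fin N → α × γ) R)
    (h : ∀ b, β * slice (kroneckerPow (routed (R := R) (trow e) (tcol e)) N) b =
      slice (kroneckerPow (routed (R := R) (trow e) (tcol e)) N) b * γ')
    (v w : Fin N → α × γ) (i₀ : Fin N) (hψ : ¬ IsProdPerm (rel e (v i₀).2 (w i₀).2)) :
    γ' v w = 0 := by
  rw [transfer_snd e β γ' h v w (fun _ => (v i₀).1)]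
  split_ifs with hc
  · exact fst_eq_zero_of_not_isProdPerm e β γ' h _ _ i₀ hψ
  · rfl

end Transfer

/-! ## The `φ`-twisted star -/

section PermStar

variable (K : Type*) [Field K]

/-- **The `φ`-twisted star `𝔖_φ`**: slots as for `twistedStar`; the `inl` leaf is `⟨n,n,L⟩` itself,
the `inr` leaf reads the entry `X_b` at the moved position `φ b` (`(X, (Y,Y')) ↦ (XY, φ(X)Y')`,
`φ(X)_{φ b} = X_b`); mixed blocks vanish. [folklore] -/
def permStar (n L : ℕ) (φ : Equiv.Perm (Fin n × Fin n)) :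
    (Fin n × Fin L) ⊕ (Fin n × Fin L) → Fin n × Fin n → (Fin n × Fin L) ⊕ (Fin n × Fin L) → K
  | Sum.inl a, b, Sum.inl c => matMulTensor K n n L a b c
  | Sum.inr a, b, Sum.inr c => matMulTensor K n n L a (φ b) c
  | _, _, _ => 0

/-- `𝔖_φ` in leaf coordinates `Fin n × (Fin L ⊕ Fin L)`. [folklore] -/
def permLeaf (n L : ℕ) (φ : Equiv.Perm (Fin n × Fin n)) (u : Fin n × (Fin L ⊕ Fin L))
    (b : Fin n × Fin n) (w : Fin n × (Fin L ⊕ Fin L)) : K :=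
  permStar K n L φ (Equiv.prodSumDistrib _ _ _ u) b (Equiv.prodSumDistrib _ _ _ w)

variable {K}

/-- The `(inl, inl)` block of `𝔖_φ` is `⟨n,n,L⟩` (definitional unfolding). [folklore] -/
@[simp] theorem permStar_inl_inl (n L : ℕ) (φ : Equiv.Perm (Fin n × Fin n)) (a : Fin n × Fin L)
    (b : Fin n × Fin n) (c : Fin n × Fin L) :
    permStar K n L φ (Sum.inl a) b (Sum.inl c) = matMulTensor K n n L a b c := rfl

/-- The `(inr, inr)` block of `𝔖_φ` is `⟨n,n,L⟩` read through `φ` (definitional unfolding). [folklore] -/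
@[simp] theorem permStar_inr_inr (n L : ℕ) (φ : Equiv.Perm (Fin n × Fin n)) (a : Fin n × Fin L)
    (b : Fin n × Fin n) (c : Fin n × Fin L) :
    permStar K n L φ (Sum.inr a) b (Sum.inr c) = matMulTensor K n n L a (φ b) c := rfl

/-- The mixed block `(inl, inr)` of `𝔖_φ` vanishes (definitional unfolding). [folklore] -/
@[simp] theorem permStar_inl_inr (n L : ℕ) (φ : Equiv.Perm (Fin n × Fin n)) (a : Fin n × Fin L)
    (b : Fin n × Fin n) (c : Fin n × Fin L) : permStar K n L φ (Sum.inl a) b (Sum.inr c) = 0 := rfl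

/-- The mixed block `(inr, inl)` of `𝔖_φ` vanishes (definitional unfolding). [folklore] -/
@[simp] theorem permStar_inr_inl (n L : ℕ) (φ : Equiv.Perm (Fin n × Fin n)) (a : Fin n × Fin L)
    (b : Fin n × Fin n) (c : Fin n × Fin L) : permStar K n L φ (Sum.inr a) b (Sum.inl c) = 0 := rfl

/-- **The transpose twist is the twisted star**: `𝔖_ᵀ = 𝔖_n(L)`. [folklore] -/
theorem permStar_prodComm (n L : ℕ) :
    permStar K n L (Equiv.prodComm (Fin n) (Fin n)) = twistedStar K n L := by
  funext a b c
  rcases a with a | a <;> rcases c with c | c <;> simp [permStar]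

/-- The transpose is not a product permutation (`n ≥ 2`): it moves the row of `(0,0)` off the row
of `(0,1)`. [folklore] -/
theorem not_isProdPerm_prodComm {n : ℕ} (hn : 2 ≤ n) :
    ¬ IsProdPerm (Equiv.prodComm (Fin n) (Fin n)) := by
  rintro ⟨σ, τ, h⟩
  have h₀ := h (⟨0, by omega⟩, ⟨0, by omega⟩)
  have h₁ := h (⟨0, by omega⟩, ⟨1, by omega⟩)
  simp only [Equiv.prodComm_apply, Prod.swap_prod_mk, Prod.mk.injEq] at h₀ h₁
  have e : (⟨0, by omega⟩ : Fin n) = ⟨1, by omega⟩ := h₀.1.trans h₁.1.symm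
  exact absurd (Fin.ext_iff.mp e) (by norm_num)

/-- The change to leaf coordinates is a relabelling: a degeneration `⟨n,n,2L⟩^{⊠N} ⊵ 𝔖_φ^{⊠N}` is
a degeneration `cohLeaf^{⊠N} ⊵ permLeaf^{⊠N}`. [cite: BurgisserClausenShokrollahi1997, (15.20)] -/
theorem algDegeneratesTo_permLeaf {n L N : ℕ} {φ : Equiv.Perm (Fin n × Fin n)}
    (h : AlgDegeneratesTo (kroneckerPow (matMulTensor K n n (L + L)) N)
      (kroneckerPow (permStar K n L φ) N)) :
    AlgDegeneratesTo (kroneckerPow (cohLeaf K n L) N) (kroneckerPow (permLeaf K n L φ) N) := by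
  obtain ⟨h, A, B, C, hd⟩ := h
  have h₁ := hd.source_equiv
    (Equiv.piCongrRight fun _ : Fin N => (Equiv.refl (Fin n)).prodCongr
      (finSumFinEquiv : Fin L ⊕ Fin L ≃ Fin (L + L)))
    (Equiv.refl (Fin N → Fin n × Fin n))
    (Equiv.piCongrRight fun _ : Fin N => (Equiv.refl (Fin n)).prodCongr
      (finSumFinEquiv : Fin L ⊕ Fin L ≃ Fin (L + L)))
  have h₂ := h₁.precomp
    (fun x : Fin N → Fin n × (Fin L ⊕ Fin L) => fun i => Equiv.prodSumDistrib _ _ _ (x i)) id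
    (fun z : Fin N → Fin n × (Fin L ⊕ Fin L) => fun i => Equiv.prodSumDistrib _ _ _ (z i))
  exact ⟨h, _, _, _, h₂⟩

end PermStar

end Summit.MatrixMultiplication.MatrixMultiplication.Theorems.FarEdgeDescentTwistRigidity

end
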